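import Literature.AnabelianGeometry.EtaleTheta.Discharge.Sec3RealSpanTateTowerNormalForm
import Literature.AnabelianGeometry.EtaleTheta.Discharge.Sec4BaseRootLawAtKummerTateTower
import HarnessLib

/-!
# [EtTh] Prop. 3.4 (ii), the `Λ = ℝ` effective-locus clause `hE`, PROVED at the v2 MODEL OF RECORD (the Kummer–Tate tower
# `TateTowerKummer.tower`, Def. 3.3 (iii) with covering-indexed `Mero`, `DivisorMonoids.ofTower`)

S. Mochizuki, *The étale theta function and its Frobenioid-theoretic manifestations*, Publ. RIMS **45** (2009), Prop. 3.4 (ii)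
p.74 read at the monoid type `Λ = ℝ` of Def. 3.6 (i) p.76 (`B₀^ℝ := ℝ·Φ₀^birat`, `F₀^ℝ := ℝ·Φ₀^cnst`); Def. 3.3 (iii) pp.73–74
(«the inductive limits range over the `Δ^fil`-closures `Z^log_∞ → Y^log`») [cite: MochizukiEtTh2009, Prop 3.4 (ii) p.74];
the `ℝ`-vector spaces `(Φ₀(Y)^rlf)^gp`: [FrdI] Def. 2.4 (i) p.48 / Prop. 5.3 p.103 [cite: MochizukiFrdI2008, Def. 2.4(i) p.48].

abc-iut cell, layer L2, seat abc-iut-L2-d2 (gen 5); self-named row after abc-iut-L2-lead R573 (memo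
`staging/L2/L2-d2/census/VNEXT-V2-RealifiedChain-L2d2.md`, item (c)).  PROOF-ONLY.  Abc-iut-L2-t3's v2 interface
(`LogDivisorTower`, `DivisorMonoids.ofTower`, tree) reads every connected tempered covering `Y : B^temp(Π)⁰` at the level of ITS
`Δ^fil`-closure; its model of record `TateTowerKummer.tower` (tree; E2 root law AND non-degeneracy coexist there) has EVERY level
equal to abc-iut-w6-d058's skeleton `TateTower.model` with `Grp = ℤγ × (ℕ → ℤ)` acting through `γ`
(`act = TateTower.action.comap fst`, `tower.act n = act` for all `n` — `rfl`).  Hence `(ofTower tower).Φ₀(Y) = act.phiZero (gset Y)`,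
`B₀(Y) = act.bZero (gset Y)`, `div₀ = act.divZeroHom`, `F₀ = act.fZero` DEFINITIONALLY, and the census-A2 binder `hE` at the v2 model
of record is the statement proved here, `TateTowerKummer.effRealSpan_ofTower` — by the argument of `Sec3RealSpanTateTowerNormalForm` /
`Sec3EffRealSpanTateTower` (p460624 / p461088, v1 model of record), whose §1–§2 toolkit is reused BY NAME:

* §A the skeleton lemmas GENERALISED to an arbitrary action `A` of a group `G` on `TateTower.model` acting on functions through
  shears (`hA : A.actFn g f = shearFn (t g) f`): divisors read at a component (`val_divAt_inr_action`, action-free), constancy of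
  shear-fixed equivariant functions on transitive sets, the power relation `b^{k₀} = ϖ^{c k₀ − c₀ k}·b₀^k` in `B₀(S)`, and
  abc-iut-w6-d052's `div₀ b = [Σ_j F_j]^c` for constant-valued `b` (`divZero_eq_zpow_of_forall_eq_action`);
* §B at `(ofTower tower, Y)`: the multiplicity-at-`F_j` degrees `Φ₀(Y)^rlf → ℝ_{≥0}` (weak universal property of the realification
  + abc-iut-L1-d2's `supports_R_nnreal`), their value `c + k·j` on `ι(div₀ b)`, the NORMAL FORM of `ℝ·Φ₀^birat(Y)`, and
  **`effRealSpan_ofTower`**: effectivity forces `a + β(c₀ + k₀ j) ≥ 0` for all `j ∈ ℤ`, so the `U`-part vanishes.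

HONEST LABEL: elementary verification at CONSTRUCTED data; refereed pre-IUT material; nothing here bears on [IUTchIII] Cor. 3.12; no
side taken; typed ≠ proved — here proved.  The Frobenioid-level consumers at v2 (Thm. 3.7 / Cor. 3.8) wait on the rank-one re-key
(memo §2); this file is the per-datum binder only.
-/

noncomputable section

namespace Literature.AnabelianGeometry.EtaleTheta

open CategoryTheory Opposite Function NNReal Literature.AlgebraicGeometry.Frobenioids Literature.AnabelianGeometry.SemiGraphs
  LogDivisorModel LogDivisorModel.GaloisAction LogDivisorTower

/-! ## §A The skeleton under an arbitrary action by shears -/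

namespace LogDivisorModel.TateTower

open TateTowerFrd

variable {G : Type} [Group G] (A : TateTower.model.GaloisAction G) (S : Action (Type 0) G)

/-- The divisor of `b ∈ B₀(S)` at `s`, read at the component `F_j`: `c + k·j` for `b(s) = ϖ^c U^k` — for ANY action on the
skeleton (`div` does not see the action). [cite: MochizukiEtTh2009, Def 3.1 p.70] -/
theorem val_divAt_inr_action (b : A.bZero S) (s : S.V) (j : ℤ) :
    val (A.divAt S b s) (Sum.inr j) = (Multiplicative.toAdd (b.1 s)).1 + (Multiplicative.toAdd (b.1 s)).2 * j := by
  change Multiplicative.toAdd (divHom (b.1 s)) (Sum.inr j) = _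
  rw [toAdd_divHom]
  rfl

/-- `div₀ b = [N]/[D]` read at `F_j`: `(c + k·j) + mult_{F_j} D(s) = mult_{F_j} N(s)`. [cite: MochizukiEtTh2009, Def 3.3 p.73] -/
theorem val_divNum_inr_action (b : A.bZero S) (s : S.V) (j : ℤ) :
    (Multiplicative.toAdd (b.1 s)).1 + (Multiplicative.toAdd (b.1 s)).2 * j + val ((A.divDen S b).1 s) (Sum.inr j) =
      val ((A.divNum S b).1 s) (Sum.inr j) := by
  rw [← val_divAt_inr_action, ← A.divAt_mul_divDen]
  rfl

/-- The divisor at `s` of a function with constant value `ϖ^c` is `c·Σ_j [F_j]` (any action). [cite: MochizukiEtTh2009, Def 3.3 p.73] -/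
theorem divAt_eq_constDIV_action (b : A.bZero S) (s : S.V) (c : ℤ)
    (hc : b.1 s = Multiplicative.ofAdd ((c, 0) : ℤ × ℤ)) : A.divAt S b s = constDIV c := by
  change divHom (b.1 s) = constDIV c
  rw [hc]
  exact divHom_const c

/-- **`div₀` of a constant-valued element of `B₀(S)`** (abc-iut-w6-d052's `divZero_eq_zpow_of_forall_eq`, any action): if
`b s = ϖ^c` for every `s`, then `div₀ b = [d]^c` for any `d ∈ Φ₀(S)` with constant value `Σ_j [F_j]`. [cite: MochizukiEtTh2009, Prop 3.4 p.74] -/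
theorem divZero_eq_zpow_of_forall_eq_action (d : A.phiZero S) (hd : ∀ s, d.1 s = (constDIV 1 : TateTower.model.DIV))
    (b : A.bZero S) (c : ℤ) (hc : ∀ s, b.1 s = Multiplicative.ofAdd ((c, 0) : ℤ × ℤ)) :
    A.divZero S b = Algebra.GrothendieckGroup.of d ^ c := by
  have hdpow : ∀ (n : ℕ) s, (d ^ n).1 s = (constDIV n : TateTower.model.DIV) := fun n s => by
    rw [SubmonoidClass.coe_pow, Pi.pow_apply, hd]
    exact constDIV_one_pow n
  obtain ⟨n, rfl | rfl⟩ := Int.eq_nat_or_neg c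
  · rw [zpow_natCast, ← map_pow, ← div_one (Algebra.GrothendieckGroup.of (d ^ n)), ← map_one Algebra.GrothendieckGroup.of,
      A.divZero_eq_div_iff]
    intro s
    rw [divAt_eq_constDIV_action A S b s n (hc s), OneMemClass.coe_one, Pi.one_apply, mul_one, hdpow]
  · rw [zpow_neg, zpow_natCast, ← map_pow, ← one_div, ← map_one Algebra.GrothendieckGroup.of, A.divZero_eq_div_iff]
    intro s
    rw [divAt_eq_constDIV_action A S b s (-n) (hc s), OneMemClass.coe_one, Pi.one_apply, hdpow]
    exact constDIV_neg_mul n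

/-- The constant `ϖ^c` as an element of `B₀(S)`, for an action by shears `actFn g = shearFn (t g)`. [cite: MochizukiEtTh2009, Def 3.3 p.73] -/
theorem const_mem_bZero_action (t : G → ℤ) (hA : ∀ (g : G) (f : TateTower.model.Fn), A.actFn g f = shearFn (t g) f) (c : ℤ) :
    (fun _ : S.V => (Multiplicative.ofAdd ((c, 0) : ℤ × ℤ) : TateTower.model.Fn)) ∈ A.bZero S :=
  ⟨fun _ => trivial, fun g _ => ((hA g _).trans (shearFn_const (t g) c)).symm⟩

/-- The reduced special fibre `Σ_j [F_j]` as an element of `Φ₀(S)`, for an action fixing it. [cite: MochizukiEtTh2009, Def 3.3 p.73] -/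
theorem constDIV_one_mem_phiZero_action (hD : ∀ g : G, A.actDIV g (constDIV 1) = constDIV 1) :
    (fun _ : S.V => (constDIV 1 : TateTower.model.DIV)) ∈ A.phiZero S :=
  ⟨fun _ => constDIV_mem_Divplus 1, fun g _ => (hD g).symm⟩

/-- On a TRANSITIVE `G`-set, an equivariant function whose value at `s₀` is a constant `ϖ^c` is constant (action by shears).
[cite: MochizukiEtTh2009, Def 3.3 p.73] -/
theorem apply_eq_of_apply_eq_const_action (t : G → ℤ) (hA : ∀ (g : G) (f : TateTower.model.Fn), A.actFn g f = shearFn (t g) f)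
    (htrans : ∀ s u : S.V, ∃ g : G, S.ρ g s = u) (s₀ : S.V) (b : A.bZero S) {c : ℤ}
    (hc : b.1 s₀ = Multiplicative.ofAdd ((c, 0) : ℤ × ℤ)) (s : S.V) : b.1 s = Multiplicative.ofAdd ((c, 0) : ℤ × ℤ) := by
  obtain ⟨g, rfl⟩ := htrans s₀ s
  rw [b.2.2 g s₀, hc, hA, shearFn_const]

/-- **The power relation in `B₀(S)` on a transitive `G`-set** (action by shears): for `b₀(s₀) = ϖ^{c₀} U^{k₀}` and
`b(s₀) = ϖ^c U^k`, `b^{k₀} = ϖ^{c k₀ - c₀ k} · b₀^{k}`. [cite: MochizukiEtTh2009, Def 3.3 p.73] -/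
theorem zpow_eq_const_zpow_mul_zpow_action (t : G → ℤ) (hA : ∀ (g : G) (f : TateTower.model.Fn), A.actFn g f = shearFn (t g) f)
    (htrans : ∀ s u : S.V, ∃ g : G, S.ρ g s = u) (s₀ : S.V) (b₀ b : A.bZero S)
    {c₀ k₀ c k : ℤ} (hb₀ : b₀.1 s₀ = Multiplicative.ofAdd (c₀, k₀)) (hb : b.1 s₀ = Multiplicative.ofAdd (c, k)) :
    b ^ k₀ = (⟨_, const_mem_bZero_action A S t hA 1⟩ : A.bZero S) ^ (c * k₀ - c₀ * k) * b₀ ^ k := by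
  refine Subtype.ext (funext fun s => ?_)
  obtain ⟨g, rfl⟩ := htrans s₀ s
  rw [Subgroup.coe_mul, SubgroupClass.coe_zpow, SubgroupClass.coe_zpow, SubgroupClass.coe_zpow, Pi.mul_apply,
    Pi.pow_apply, Pi.pow_apply, Pi.pow_apply, b.2.2 g s₀, b₀.2.2 g s₀, hb, hb₀, hA, hA]
  change Multiplicative.toAdd ((shearFn (t g) (Multiplicative.ofAdd (c, k))) ^ k₀) =
    Multiplicative.toAdd ((Multiplicative.ofAdd ((1 : ℤ), (0 : ℤ))) ^ (c * k₀ - c₀ * k) *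
      (shearFn (t g) (Multiplicative.ofAdd (c₀, k₀))) ^ k)
  simp only [toAdd_zpow, toAdd_mul, toAdd_shearFn, toAdd_ofAdd, Prod.smul_mk, smul_eq_mul, Prod.mk_add_mk,
    Prod.mk.injEq]
  constructor <;> ring

end LogDivisorModel.TateTower

/-! ## §B The v2 model of record: the Kummer–Tate tower -/

namespace TateTowerKummer

open LogDivisorModel.TateTower TateTowerFrd RealifiedDivisorMonoids

/-- `Grp` acts on the functions of every level through `γ` by shears. [cite: MochizukiEtTh2009, Def 3.3 (iii) p.73] -/
theorem act_actFn_apply (g : Grp) (f : TateTower.model.Fn) : act.actFn g f = shearFn (Multiplicative.toAdd g.1) f := rfl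

/-- `Grp` fixes the reduced special fibre `Σ_j [F_j]` (translation of the chain). [cite: MochizukiEtTh2009, Def 3.3 (iii) p.73] -/
theorem act_actDIV_constDIV (g : Grp) : act.actDIV g (constDIV 1) = constDIV 1 := shiftDIV_constDIV _ _

/-- `z • x = x^z` for `z ∈ ℤ` in the `ℝ`-vector space of a realification datum. [cite: MochizukiFrdI2008, Def. 2.4(i) p.48] -/
private theorem rsmul_intCast {D : Type*} [Category D] {Φ : Dᵒᵖ ⥤ CommMonCat} (R : RealificationData Φ) (X : D) (z : ℤ)
    (x : Algebra.GrothendieckGroup (R.rlf.obj (op X))) : R.rsmul X (z : ℝ) x = x ^ z := by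
  cases z with
  | ofNat n => rw [Int.ofNat_eq_natCast, Int.cast_natCast, R.rsmul_natCast, zpow_natCast]
  | negSucc n => rw [Int.cast_negSucc, RealificationDataLemmas.rsmul_neg', R.rsmul_natCast, zpow_negSucc]

/-- `ι : Φ₀(Y)^gp → (Φ₀(Y)^rlf)^gp` of THE weak realification data of `ofTower tower` on a class `[φ]`.
[cite: MochizukiFrdI2008, Prop. 5.3 p.103] -/
theorem realDataWeak_toRlfGp_of (Y : ConnectedPart (BTemp Grp)) (φ : act.phiZero (gset Y)) :
    (realDataWeak (DivisorMonoids.ofTower tower) hpf).toRlfGp Y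
        (Algebra.GrothendieckGroup.of (φ : (DivisorMonoids.ofTower tower).Φ₀.obj (op Y))) =
      Algebra.GrothendieckGroup.of ((hpf (op Y)).weak.toRealification (Perfection.of _ φ)) := by
  rw [RealificationData.toRlfGp, MonGp.map_of, RealificationData.canonicalWeak_toRlf_app_hom]
  rfl

/-- **The multiplicity at `F_j`, read at a base point `s₀`, extends to an `ℝ_{≥0}`-valued degree on `Φ₀(Y)^rlf`** (weak
universal property of the realification; `ℝ` supports `ℝ_{≥0}`). [cite: MochizukiFrdI2008, Prop. 5.3 p.103] -/
theorem exists_rlfHom_val_eq (Y : ConnectedPart (BTemp Grp)) (s₀ : (gset Y).V) (j : ℤ) :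
    ∃ κ : ((realDataWeak (DivisorMonoids.ofTower tower) hpf).rlf.obj (op Y)) →* Multiplicative ℝ≥0,
      ∀ φ : act.phiZero (gset Y),
        ((Multiplicative.toAdd (κ ((hpf (op Y)).weak.toRealification (Perfection.of _ φ))) : ℝ≥0) : ℝ) =
          (val (φ.1 s₀) (Sum.inr j) : ℝ) := by
  have hnn : ∀ φ : act.phiZero (gset Y), 0 ≤ val (φ.1 s₀) (Sum.inr j) := fun φ =>
    (Submonoid.mem_inf.mp (φ.2.1 s₀)).2 (Sum.inr j)
  let χ : act.phiZero (gset Y) →* Multiplicative ℝ≥0 :=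
    { toFun := fun φ => Multiplicative.ofAdd (Real.toNNReal (val (φ.1 s₀) (Sum.inr j) : ℝ))
      map_one' := by
        have h0 : val ((1 : act.phiZero (gset Y)).1 s₀) (Sum.inr j) = 0 := rfl
        rw [h0, Int.cast_zero, Real.toNNReal_zero]
        rfl
      map_mul' := fun φ ψ => by
        have hm : val ((φ * ψ).1 s₀) (Sum.inr j) = val (φ.1 s₀) (Sum.inr j) + val (ψ.1 s₀) (Sum.inr j) := rfl
        rw [← ofAdd_add, hm, Int.cast_add, Real.toNNReal_add (Int.cast_nonneg (hnn φ)) (Int.cast_nonneg (hnn ψ))] }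
  have hχ : ∀ φ, ((Multiplicative.toAdd (χ φ) : ℝ≥0) : ℝ) = (val (φ.1 s₀) (Sum.inr j) : ℝ) := fun φ =>
    Real.coe_toNNReal _ (Int.cast_nonneg (hnn φ))
  obtain ⟨κ, hκ, -⟩ := RlfUniversalWeak.existsUnique_lift (hpf (op Y)).weak (hpf (op Y)).rlfCofinal
    ArchFrd.Thm36Sub.supports_R_nnreal
    (isPerfect_multiplicative_nnreal.equivPerfection.symm.toMonoidHom.comp
      (Literature.AlgebraicGeometry.Frobenioids.Perfection.map χ))
  refine ⟨κ, fun φ => ?_⟩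
  have h1 : κ ((hpf (op Y)).weak.toRealification (Perfection.of _ φ)) = χ φ :=
    (DFunLike.congr_fun hκ (Perfection.of _ φ)).trans (DFunLike.congr_fun (IsPerfFactorial.perfectionExtend_spec χ) φ)
  exact (congrArg (fun y : Multiplicative ℝ≥0 => ((Multiplicative.toAdd y : ℝ≥0) : ℝ)) h1).trans (hχ φ)

/-- A degree `κ` on `Φ₀(Y)^rlf`, groupified, on the class of `t ∈ Φ₀(Y)^rlf`: `κ(t)`. [cite: MochizukiFrdI2008, Def. 2.4(i) p.48] -/
theorem toAdd_lift_of_rlf (Y : ConnectedPart (BTemp Grp))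
    (κ : ((realDataWeak (DivisorMonoids.ofTower tower) hpf).rlf.obj (op Y)) →* Multiplicative ℝ≥0)
    (t : (hpf (op Y)).weak.Rlf) :
    Multiplicative.toAdd (Algebra.GrothendieckGroup.lift (PrimeCoord.toRealMul.comp κ)
        (Algebra.GrothendieckGroup.of (M := (hpf (op Y)).weak.Rlf) t)) =
      ((Multiplicative.toAdd (κ t) : ℝ≥0) : ℝ) :=
  RlfDegreeWeak.toAdd_lift_of κ t

/-- **The degree "multiplicity at `F_j`" on `ι(div₀ b)` reads `c + k·j`** for `b(s₀) = ϖ^c U^k`. [cite: MochizukiEtTh2009, Def 3.3 p.73] -/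
theorem toAdd_lift_toRlfGp_divZero (Y : ConnectedPart (BTemp Grp)) (s₀ : (gset Y).V) (j : ℤ)
    (κ : ((realDataWeak (DivisorMonoids.ofTower tower) hpf).rlf.obj (op Y)) →* Multiplicative ℝ≥0)
    (hκ : ∀ φ : act.phiZero (gset Y),
      ((Multiplicative.toAdd (κ ((hpf (op Y)).weak.toRealification (Perfection.of _ φ))) : ℝ≥0) : ℝ) =
        (val (φ.1 s₀) (Sum.inr j) : ℝ))
    (b : act.bZero (gset Y)) :
    Multiplicative.toAdd (Algebra.GrothendieckGroup.lift (PrimeCoord.toRealMul.comp κ)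
        ((realDataWeak (DivisorMonoids.ofTower tower) hpf).toRlfGp Y (act.divZero (gset Y) b))) =
      ((Multiplicative.toAdd (b.1 s₀)).1 : ℝ) + (Multiplicative.toAdd (b.1 s₀)).2 * j := by
  let ι : Algebra.GrothendieckGroup ↥(act.phiZero (gset Y)) →*
      Algebra.GrothendieckGroup ((realDataWeak (DivisorMonoids.ofTower tower) hpf).rlf.obj (op Y)) :=
    (realDataWeak (DivisorMonoids.ofTower tower) hpf).toRlfGp Y
  have hι : ∀ φ : act.phiZero (gset Y), ι (Algebra.GrothendieckGroup.of φ) =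
      Algebra.GrothendieckGroup.of ((hpf (op Y)).weak.toRealification (Perfection.of _ φ)) := fun φ =>
    realDataWeak_toRlfGp_of Y φ
  have hN := hκ (act.divNum (gset Y) b)
  have hD := hκ (act.divDen (gset Y) b)
  have hrel := congrArg (fun z : ℤ => (z : ℝ)) (val_divNum_inr_action act (gset Y) b s₀ j)
  simp only [Int.cast_add, Int.cast_mul] at hrel
  change Multiplicative.toAdd (Algebra.GrothendieckGroup.lift (PrimeCoord.toRealMul.comp κ)
    (ι (Algebra.GrothendieckGroup.of (act.divNum (gset Y) b) / Algebra.GrothendieckGroup.of (act.divDen (gset Y) b)))) = _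
  rw [map_div, map_div, toAdd_div, hι, hι, toAdd_lift_of_rlf, toAdd_lift_of_rlf, hN, hD]
  linarith

/-- `ℝ`-linearity of the degrees for the scalar action of THE weak realification data of `ofTower tower`.
[cite: MochizukiFrdI2008, Def. 2.4(i) p.48] -/
theorem toAdd_lift_rsmul (Y : ConnectedPart (BTemp Grp))
    (κ : ((realDataWeak (DivisorMonoids.ofTower tower) hpf).rlf.obj (op Y)) →* Multiplicative ℝ≥0) (r : ℝ)
    (ξ : Algebra.GrothendieckGroup ((realDataWeak (DivisorMonoids.ofTower tower) hpf).rlf.obj (op Y))) :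
    Multiplicative.toAdd (Algebra.GrothendieckGroup.lift (PrimeCoord.toRealMul.comp κ)
        ((realDataWeak (DivisorMonoids.ofTower tower) hpf).rsmul Y r ξ)) =
      r * Multiplicative.toAdd (Algebra.GrothendieckGroup.lift (PrimeCoord.toRealMul.comp κ) ξ) :=
  RlfDegreeWeak.toAdd_lift_realSMul (hpf (op Y)).weak κ r ξ

/-- **Normal form of `ℝ·Φ₀^birat(Y)` at the v2 model of record**: with a base point `s₀` and a reference function `b₀ ∈ B₀(Y)`,
`b₀(s₀) = ϖ^{c₀} U^{k₀}`, such that `k₀ ≠ 0` as soon as some `b ∈ B₀(Y)` has a `U`-part at `s₀`, every element of `ℝ·Φ₀^birat(Y)` is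
`a • ι[Σ_j F_j] · β • ι(div₀ b₀)`. [cite: MochizukiFrdI2008, Prop. 5.3 p.103] -/
theorem exists_eq_rsmul_mul_rsmul (Y : ConnectedPart (BTemp Grp)) (s₀ : (gset Y).V) (b₀ : act.bZero (gset Y)) {c₀ k₀ : ℤ}
    (hb₀ : b₀.1 s₀ = Multiplicative.ofAdd (c₀, k₀))
    (H : ∀ b : act.bZero (gset Y), (Multiplicative.toAdd (b.1 s₀)).2 ≠ 0 → k₀ ≠ 0)
    {ξ : Algebra.GrothendieckGroup ((realDataWeak (DivisorMonoids.ofTower tower) hpf).rlf.obj (op Y))}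
    (hξ : ξ ∈ ((realDataWeak (DivisorMonoids.ofTower tower) hpf).realSpan (DivisorMonoids.ofTower tower).biratGp).carrier Y) :
    ∃ a β : ℝ, ξ =
      (realDataWeak (DivisorMonoids.ofTower tower) hpf).rsmul Y a
          ((realDataWeak (DivisorMonoids.ofTower tower) hpf).toRlfGp Y (Algebra.GrothendieckGroup.of
            ((⟨_, constDIV_one_mem_phiZero_action act (gset Y) act_actDIV_constDIV⟩ : act.phiZero (gset Y)) :
              (DivisorMonoids.ofTower tower).Φ₀.obj (op Y)))) *
        (realDataWeak (DivisorMonoids.ofTower tower) hpf).rsmul Y β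
          ((realDataWeak (DivisorMonoids.ofTower tower) hpf).toRlfGp Y (act.divZero (gset Y) b₀)) := by
  have htrans := ((BTemp.isConnectedObj_iff Y.obj).mp Y.property).2
  let R := realDataWeak (DivisorMonoids.ofTower tower) hpf
  let ι : Algebra.GrothendieckGroup ↥(act.phiZero (gset Y)) →* Algebra.GrothendieckGroup (R.rlf.obj (op Y)) := R.toRlfGp Y
  let d : act.phiZero (gset Y) := ⟨_, constDIV_one_mem_phiZero_action act (gset Y) act_actDIV_constDIV⟩
  let G₁ := ι (Algebra.GrothendieckGroup.of d)
  let g₀ := ι (act.divZero (gset Y) b₀)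
  let P : Algebra.GrothendieckGroup (R.rlf.obj (op Y)) → Prop := fun x => ∃ a β : ℝ, x = R.rsmul Y a G₁ * R.rsmul Y β g₀
  have P1 : P 1 := ⟨0, 0, by rw [R.rsmul_zero, R.rsmul_zero, mul_one]⟩
  have Pmul : ∀ x y, P x → P y → P (x * y) := by
    rintro x y ⟨a, β, rfl⟩ ⟨a', β', rfl⟩
    exact ⟨a + a', β + β', by rw [R.rsmul_add, R.rsmul_add, mul_mul_mul_comm]⟩
  have Pinv : ∀ x, P x → P x⁻¹ := by
    rintro x ⟨a, β, rfl⟩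
    exact ⟨-a, -β, by rw [RealificationDataLemmas.rsmul_neg', RealificationDataLemmas.rsmul_neg', mul_inv]⟩
  have Psmul : ∀ (r : ℝ) x, P x → P (R.rsmul Y r x) := by
    rintro r x ⟨a, β, rfl⟩
    exact ⟨r * a, r * β, by rw [map_mul, R.rsmul_mul, R.rsmul_mul]⟩
  have hd : ∀ s, d.1 s = (constDIV 1 : TateTower.model.DIV) := fun _ => rfl
  have hϖ : act.divZero (gset Y) ⟨_, const_mem_bZero_action act (gset Y) (fun g => Multiplicative.toAdd g.1) act_actFn_apply 1⟩ =
      Algebra.GrothendieckGroup.of d := by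
    have h := divZero_eq_zpow_of_forall_eq_action act (gset Y) d hd
      ⟨_, const_mem_bZero_action act (gset Y) (fun g => Multiplicative.toAdd g.1) act_actFn_apply 1⟩ 1 (fun _ => rfl)
    rw [zpow_one] at h
    exact h
  have Pgen : ∀ b : act.bZero (gset Y), P (ι (act.divZero (gset Y) b)) := by
    intro b
    by_cases hk : (Multiplicative.toAdd (b.1 s₀)).2 = 0
    · have hc0 : b.1 s₀ = Multiplicative.ofAdd (((Multiplicative.toAdd (b.1 s₀)).1, 0) : ℤ × ℤ) :=
        Multiplicative.toAdd.injective (Prod.ext rfl hk)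
      have hc := apply_eq_of_apply_eq_const_action act (gset Y) (fun g => Multiplicative.toAdd g.1) act_actFn_apply htrans
        s₀ b hc0
      refine ⟨(Multiplicative.toAdd (b.1 s₀)).1, 0, ?_⟩
      rw [divZero_eq_zpow_of_forall_eq_action act (gset Y) d hd b _ hc, map_zpow, R.rsmul_zero, mul_one,
        rsmul_intCast]
    · have hk₀ : k₀ ≠ 0 := H b hk
      have hpow := zpow_eq_const_zpow_mul_zpow_action act (gset Y) (fun g => Multiplicative.toAdd g.1) act_actFn_apply htrans
        s₀ b₀ b hb₀
        (rfl : b.1 s₀ = Multiplicative.ofAdd ((Multiplicative.toAdd (b.1 s₀)).1, (Multiplicative.toAdd (b.1 s₀)).2))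
      have h2 := congrArg (ι.comp (act.divZeroHom (gset Y))) hpow
      simp only [map_zpow, map_mul, MonoidHom.comp_apply, LogDivisorModel.GaloisAction.divZeroHom_apply, hϖ] at h2
      exact ⟨_, _, RealificationDataLemmas.eq_rsmul_mul_rsmul_of_zpow_eq R Y hk₀ h2⟩
  have Pbirat : ∀ c ∈ (DivisorMonoids.ofTower tower).biratGp.carrier Y, P (R.toRlfGp Y c) := by
    intro c hc
    induction hc using Subgroup.closure_induction with
    | mem y hy =>
      obtain ⟨b, rfl⟩ := hy
      exact Pgen b
    | one => rw [map_one]; exact P1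
    | mul y z _ _ hy hz => rw [map_mul]; exact Pmul _ _ hy hz
    | inv y _ hy => rw [map_inv]; exact Pinv _ hy
  have key : ∀ x ∈ (R.realSpan (DivisorMonoids.ofTower tower).biratGp).carrier Y, P x := by
    intro x hx
    induction hx using Subgroup.closure_induction with
    | mem y hy =>
      obtain ⟨r, c, hc, rfl⟩ := hy
      exact Psmul r _ (Pbirat c hc)
    | one => exact P1
    | mul y z _ _ hy hz => exact Pmul _ _ hy hz
    | inv y _ hy => exact Pinv _ hy
  exact key ξ hξ

/-- If `A + B j ≥ 0` for every integer `j`, then `B = 0`. [folklore] -/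
private theorem eq_zero_of_forall_int_nonneg {A B : ℝ} (h : ∀ j : ℤ, 0 ≤ A + B * j) : B = 0 := by
  by_contra hB
  rcases lt_or_gt_of_ne hB with hB' | hB'
  · obtain ⟨j, hj⟩ := exists_int_gt (-A / B)
    have h1 : B * (j : ℝ) < B * (-A / B) := mul_lt_mul_of_neg_left hj hB'
    have h3 := h j
    rw [mul_div_cancel₀ (-A) hB] at h1
    linarith
  · obtain ⟨j, hj⟩ := exists_int_lt (-A / B)
    have h1 : B * (j : ℝ) < B * (-A / B) := mul_lt_mul_of_pos_left hj hB'
    have h3 := h j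
    rw [mul_div_cancel₀ (-A) hB] at h1
    linarith

/-- **The `Λ = ℝ` effective-locus clause `hE` of [EtTh] Prop. 3.4 (ii) (census A2) HOLDS at the v2 MODEL OF RECORD**: at every connected
tempered covering `Y : B^temp(Grp)⁰` of the Kummer–Tate tower, read at the level of its `Δ^fil`-closure (`DivisorMonoids.ofTower tower`),
an element of `ℝ·Φ₀^birat(Y)` which is the class of an element of `Φ₀(Y)^rlf` lies in `ℝ·Φ₀^cnst(Y)`.
[cite: MochizukiEtTh2009, Prop 3.4 (ii) p.74] -/
theorem effRealSpan_ofTower (Y : ConnectedPart (BTemp Grp))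
    (b : Algebra.GrothendieckGroup ((realDataWeak (DivisorMonoids.ofTower tower) hpf).rlf.obj (op Y)))
    (x : (hpf (op Y)).weak.Rlf)
    (hb : b ∈ ((realDataWeak (DivisorMonoids.ofTower tower) hpf).realSpan (DivisorMonoids.ofTower tower).biratGp).carrier Y)
    (hbx : b = Algebra.GrothendieckGroup.of x) :
    b ∈ ((realDataWeak (DivisorMonoids.ofTower tower) hpf).realSpan (DivisorMonoids.ofTower tower).cnstGp).carrier Y := by
  classical
  obtain ⟨⟨s₀⟩, htrans⟩ := (BTemp.isConnectedObj_iff Y.obj).mp Y.property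
  have hG₁ : Algebra.GrothendieckGroup.of ((⟨_, constDIV_one_mem_phiZero_action act (gset Y) act_actDIV_constDIV⟩ :
      act.phiZero (gset Y)) : (DivisorMonoids.ofTower tower).Φ₀.obj (op Y)) ∈ (DivisorMonoids.ofTower tower).cnstGp.carrier Y := by
    refine (DivisorMonoids.ofTower tower).mem_cnstGp_of_mem_cnst Y
      ⟨⟨_, const_mem_bZero_action act (gset Y) (fun g => Multiplicative.toAdd g.1) act_actFn_apply 1⟩,
        fun _ => ofAdd_const_mem_const 1, ?_⟩
    have h := divZero_eq_zpow_of_forall_eq_action act (gset Y) ⟨_, constDIV_one_mem_phiZero_action act (gset Y) act_actDIV_constDIV⟩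
      (fun _ => rfl) ⟨_, const_mem_bZero_action act (gset Y) (fun g => Multiplicative.toAdd g.1) act_actFn_apply 1⟩ 1 (fun _ => rfl)
    rw [zpow_one] at h
    exact h
  by_cases hU : ∃ b' : act.bZero (gset Y), (Multiplicative.toAdd (b'.1 s₀)).2 ≠ 0
  · obtain ⟨b₀, hk₀⟩ := hU
    obtain ⟨a, β, hξ⟩ := exists_eq_rsmul_mul_rsmul Y s₀ b₀ (c₀ := (Multiplicative.toAdd (b₀.1 s₀)).1)
      (k₀ := (Multiplicative.toAdd (b₀.1 s₀)).2) rfl (fun _ _ => hk₀) hb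
    have hβ : β * (Multiplicative.toAdd (b₀.1 s₀)).2 = 0 := by
      refine eq_zero_of_forall_int_nonneg (A := a + β * (Multiplicative.toAdd (b₀.1 s₀)).1) fun j => ?_
      obtain ⟨κ, hκ⟩ := exists_rlfHom_val_eq Y s₀ j
      have h0 : 0 ≤ Multiplicative.toAdd (Algebra.GrothendieckGroup.lift (PrimeCoord.toRealMul.comp κ) b) := by
        rw [hbx]
        exact RlfDegreeWeak.toAdd_lift_of_nonneg κ x
      have h1 : ((Multiplicative.toAdd (κ ((hpf (op Y)).weak.toRealification (Perfection.of _
          ((⟨_, constDIV_one_mem_phiZero_action act (gset Y) act_actDIV_constDIV⟩ : act.phiZero (gset Y)))))) : ℝ≥0) : ℝ) =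
          1 := by
        rw [hκ]
        exact Int.cast_one
      rw [hξ, map_mul, toAdd_mul, toAdd_lift_rsmul, toAdd_lift_rsmul, toAdd_lift_toRlfGp_divZero Y s₀ j κ hκ b₀,
        realDataWeak_toRlfGp_of, toAdd_lift_of_rlf, h1] at h0
      linarith
    have hβ0 : β = 0 := (mul_eq_zero.mp hβ).resolve_right (Int.cast_ne_zero.mpr hk₀)
    rw [hξ, hβ0, (realDataWeak (DivisorMonoids.ofTower tower) hpf).rsmul_zero, mul_one]
    exact Subgroup.subset_closure ⟨a, _, hG₁, rfl⟩
  · obtain ⟨a, β, hξ⟩ :=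
      exists_eq_rsmul_mul_rsmul Y s₀ 1 (c₀ := 0) (k₀ := 0) rfl (fun b' hb' => (hU ⟨b', hb'⟩).elim) hb
    have h1 : (realDataWeak (DivisorMonoids.ofTower tower) hpf).toRlfGp Y (act.divZero (gset Y) 1) = 1 := by
      have h := map_one (act.divZeroHom (gset Y))
      rw [LogDivisorModel.GaloisAction.divZeroHom_apply] at h
      rw [h]
      exact map_one ((realDataWeak (DivisorMonoids.ofTower tower) hpf).toRlfGp Y)
    rw [hξ, h1, map_one, mul_one]
    exact Subgroup.subset_closure ⟨a, _, hG₁, rfl⟩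

end TateTowerKummer

end Literature.AnabelianGeometry.EtaleTheta

end
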